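import Summits.AtomisticToContinuum.Crystallization.Theorems.FrustrationRangeCertificatesPatternPricedCertificatesBridge
import Summits.AtomisticToContinuum.Crystallization.Theorems.FrustrationRangeCertificatesPatternPricedCertificatesStubMeanCampbell

/-!
# Crux `PatternPricedCertificates` (stmt-AtomisticToContinuum-12974), line `registered`: the bridge with the Campbell identity discharged

`PatternPricedCertificates` from the uniqueness of the optimal Lennard-Jones hcp parameters (stub B5) and `PalmRigidity` (stmt-9224) alone:
the Campbell identity B2a is the landed `stub_meanCampbell`. `[folklore]`
-/

noncomputable section

namespace Summit.AtomisticToContinuum.Crystallization.Theorems.PatternPricedCertificates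

/-- **The crux from hcp uniqueness and the σ-additive Palm rigidity** (conditional result; every other ingredient of line `registered` is
a theorem of the tree): `(B5: hcp uniqueness) → PalmRigidity (stmt-AtomisticToContinuum-9224) → PatternPricedCertificates`. [folklore] -/
theorem patternPricedCertificates_of_hcpUnique_of_palmRigidity :
    (∃ P : Literature.MathematicalPhysics.StatisticalMechanics.PeriodicConfiguration 3, ∀ (a h : ℝ) (ha : a ≠ 0) (hh : h ≠ 0), 1 / 2 ≤ a → a ≤ 2 → 1 / 2 ≤ h → h ≤ 2 →
      (Literature.MathematicalPhysics.StatisticalMechanics.hcpPeriodicConfiguration ha hh).energyPerParticle Literature.MathematicalPhysics.StatisticalMechanics.lennardJones = (⨅ Q : Literature.MathematicalPhysics.StatisticalMechanics.PeriodicConfiguration 3, Q.energyPerParticle Literature.MathematicalPhysics.StatisticalMechanics.lennardJones) →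
      ∃ L : (EuclideanSpace ℝ (Fin 3)) ≃ₗᵢ[ℝ] (EuclideanSpace ℝ (Fin 3)), (⇑L) '' P.points = Literature.MathematicalPhysics.StatisticalMechanics.hcpStacking a h) →
    Summit.AtomisticToContinuum.Crystallization.Theses.PalmUnimodularRigidity.PalmRigidity →
    Summit.AtomisticToContinuum.Crystallization.Theses.FrustrationRangeCertificates.PatternPricedCertificates :=
  patternPricedCertificates_of_palmRigidity stub_meanCampbell

end Summit.AtomisticToContinuum.Crystallization.Theorems.PatternPricedCertificates

end
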